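/-
Copyright: the b2b-balaban T⁴-continuum CRUX team, row NE7b OWNER lineage `t4-ne7b-p1` (gen 139). Project licence.
-/
import Summits.QuantumFields.BalabanUV.T4Continuum.Spine.NE7b.SupOneSiteGibbsLipschitz
import Summits.QuantumFields.BalabanUV.T4Continuum.Spine.NE7b.SupCoordinateLipschitzClass

/-!
# THE ONE-SITE RESAMPLING OPERATOR (single-site Gibbs sampler) PROPAGATES COORDINATE-LIPSCHITZ VECTORS BY DOBRUSHIN'S UPDATE
# (SCOPING (d10)(2), hypothesis (P1) of (442)): for a potential `V` on `ℝ^ι` with partial derivatives `∂_xV = V₁ x` along every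
# coordinate line, diagonal FLOOR `c_x > 0` and CEILING `Cw` (secant form along the `x`-line) and CROSS letters
# `|∂_xV(ω^{z,s}) − ∂_xV(ω^{z,t})| ≤ J_{xz}|s − t|` (`z ≠ x`), the operator
#   `(P_xF)(ω) = ∫F(ω^{x,s})e^{−V(ω^{x,s})}ds ∕ ∫e^{−V(ω^{x,s})}ds`   (resample `ω_x` from its conditional law)
# maps an observable with coordinate-Lipschitz vector `a` to one with vector `A_xa`:  `(A_xa)_x = 0`,
#   `(A_xa)_z = a_z + (J_{xz}∕c_x)·a_x`  (`z ≠ x`)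
# — the direct dependence through `F` plus Dobrushin's coefficient `C_{xz} = J_{xz}∕c_x` from (444) (row NE7b, node U5c; (441), (443),
# (444) BY NAME; [folklore])

Cell `pub-balaban`, sub-cell `t4`, spine estimate NE7b (`T4WeightBudget.RelWeightBound`; the cell's OWN estimate — NOT PRINTED in
[Bałaban 1983–89], NOT PROVED).  Crux-route work under `Spine/NE7b/` by the row OWNER (`t4-ne7b-p1` gen 139, file (445)) under FREEZE
(0)'s crux-prover clause; NOTHING of Bałaban's is named as a Lean object, valued or asserted; no `T4Continuum/Support` leaf typed; no
`def`, no notation (the operator `P` is a hypothesis-characterised variable, `hP`); zero `sorry`.  Imports (BY NAME): the OWNER's (444)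
`…SupOneSiteGibbsLipschitz` (`gibbs_mean_lipschitz`), (443) (`integrable_of_le_exp`, `integral_exp_neg_pos`, `integrable_exp_neg`,
`lip_bound`, `lip_continuous`), (441) `…SupCoordinateLipschitzClass` (`lipVec_nonneg`).

WHAT IS PROVED ([folklore]; `V : (ι → ℝ) → ℝ`, `V₁ : ι → (ι → ℝ) → ℝ`, class member `F` with vector `a`):
* §1 the coordinate line at `(ω, x)`: `line_hasDerivAt` (`s ↦ V(ω^{x,s})` has derivative `V₁ x (ω^{x,s})`), `line_obs_integrable` (the line
  weight and the line observable are integrable, the line normalisation is positive).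
* §2 the operator: `resample_update_self` (`P_xF(ω^{x,t}) = P_xF(ω)`), `resample_abs_sub_le_direct` (the direct part `a_z|s−t|`),
  `resample_abs_sub_le_cross` (the measure part `(J_{xz}∕c_x)a_x|s−t|`, by (444)), **`resample_lipVec`** (THE END: the vector `A_xa`).
* §3 toy (kernel): for `ι = Fin 1` the update vector of `a` at the resampled site is `0`.

HONEST (what this is NOT).  (P1) only; invariance (P2) and the one-step loss (P3) are (446), the assembly with (442) and the road instance
(447)–(448).  Scalar skeleton ((A3), NC-NE7b-α UNRULED); nothing of Bałaban's asserted.  BY-NAME EFFECT ON THE WALL: NONE.  NE7b NOT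
PRINTED ∕ NOT PROVED; spine PROVED 0∕9; rung (B)+1 — the programme's measures remain FINITE-torus statements; NOT the mass gap, NOT Clay.
HONEST DEPENDENCY: continuum YM on T⁴ ⇐ BetaPertH ∧ nine spine estimates (0∕9 proved); BetaPertH ⇐ (D1) ∧ (D4) ∧ CAP+tail; G-an2-4 gates
asym, D1 and NE2∕3∕4.
-/

set_option autoImplicit false

noncomputable section

namespace Summit.QuantumFields.BalabanUV.T4Continuum.NE7b.SupOneSiteResampling

open MeasureTheory Real Set Function
open SupOneSiteGibbsLipschitz (gibbs_mean_lipschitz)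
open SupOneSiteGibbsLetters (integrable_of_le_exp integral_exp_neg_pos integrable_exp_neg lip_bound lip_continuous)
open SupCoordinateLipschitzClass (lipVec_nonneg)

variable {ι : Type} [DecidableEq ι]

variable {V : (ι → ℝ) → ℝ} {V₁ : ι → (ι → ℝ) → ℝ} {c : ι → ℝ} {Cw : ℝ} {J : ι → ι → ℝ}
  {P : ι → ((ι → ℝ) → ℝ) → ((ι → ℝ) → ℝ)} {F : (ι → ℝ) → ℝ} {a : ι → ℝ}

/-! ## §1. The coordinate line -/

/-- **The line potential is `C¹`**: `s ↦ V(ω^{x,s})` has derivative `V₁ x (ω^{x,s})` at every `s`. [folklore] -/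
theorem line_hasDerivAt (hV : ∀ x ω, HasDerivAt (fun s => V (update ω x s)) (V₁ x ω) (ω x)) (x : ι) (ω : ι → ℝ) (s : ℝ) :
    HasDerivAt (fun s => V (update ω x s)) (V₁ x (update ω x s)) s := by
  have h := hV x (update ω x s)
  simp only [update_idem, update_self] at h
  exact h

/-- The line weight and the line observable are integrable; the line normalisation is positive. [folklore] -/
theorem line_obs_integrable (hV : ∀ x ω, HasDerivAt (fun s => V (update ω x s)) (V₁ x ω) (ω x))
    (hfloor : ∀ x ω s t, c x * (s - t) ^ 2 ≤ (V₁ x (update ω x s) - V₁ x (update ω x t)) * (s - t)) (hc : ∀ x, 0 < c x)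
    (hF : ∀ z ω s t, |F (update ω z s) - F (update ω z t)| ≤ a z * |s - t|) (x : ι) (ω : ι → ℝ) :
    Integrable (fun s => F (update ω x s) * exp (-V (update ω x s))) ∧ Integrable (fun s => exp (-V (update ω x s))) ∧
      0 < ∫ s, exp (-V (update ω x s)) := by
  have hw := line_hasDerivAt hV x ω
  have hm : ∀ s t, c x * (s - t) ^ 2 ≤ (V₁ x (update ω x s) - V₁ x (update ω x t)) * (s - t) := hfloor x ω
  refine ⟨?_, integrable_exp_neg hw hm (hc x), integral_exp_neg_pos hw hm (hc x)⟩
  exact integrable_of_le_exp hw hm (hc x) (lip_continuous (hF x ω)).measurable (M := |F (update ω x 0)| + a x) (K := 1)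
    fun s => by rw [one_mul]; exact lip_bound (h := fun s => F (update ω x s)) (hF x ω) s

/-! ## §2. The resampling operator -/

/-- **`P_xF` does not depend on `ω_x`**: `P_xF(ω^{x,t}) = P_xF(ω)`. [folklore] -/
theorem resample_update_self
    (hP : ∀ x F ω, P x F ω = (∫ s, F (update ω x s) * exp (-V (update ω x s))) / ∫ s, exp (-V (update ω x s))) (x : ι) (F : (ι → ℝ) → ℝ)
    (ω : ι → ℝ) (t : ℝ) : P x F (update ω x t) = P x F ω := by
  rw [hP, hP]
  simp only [update_idem]

/-- **The direct part**: for `z ≠ x`, moving `ω_z` from `t` to `s` inside the OBSERVABLE costs at most `a_z|s − t|`: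
`|∫F(ω^{z,s;x,u})e^{−V(ω^{z,s;x,u})}du ∕ Z − ∫F(ω^{z,t;x,u})e^{−V(ω^{z,s;x,u})}du ∕ Z| ≤ a_z|s−t|` (same weight). [folklore] -/
theorem resample_abs_sub_le_direct (hV : ∀ x ω, HasDerivAt (fun s => V (update ω x s)) (V₁ x ω) (ω x))
    (hfloor : ∀ x ω s t, c x * (s - t) ^ 2 ≤ (V₁ x (update ω x s) - V₁ x (update ω x t)) * (s - t)) (hc : ∀ x, 0 < c x)
    (hF : ∀ z ω s t, |F (update ω z s) - F (update ω z t)| ≤ a z * |s - t|) {x z : ι} (hzx : z ≠ x) (ω : ι → ℝ) (s t : ℝ) :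
    |(∫ u, F (update (update ω z s) x u) * exp (-V (update (update ω z s) x u))) / (∫ u, exp (-V (update (update ω z s) x u))) -
        (∫ u, F (update (update ω z t) x u) * exp (-V (update (update ω z s) x u))) / (∫ u, exp (-V (update (update ω z s) x u)))| ≤
      a z * |s - t| := by
  obtain ⟨hIs, hI0, hZ⟩ := line_obs_integrable hV hfloor hc hF x (update ω z s)
  -- the second integrand is the line observable of `ω^{z,t}` against the weight of `ω^{z,s}`: integrable by domination
  have hpt : ∀ u, |F (update (update ω z s) x u) - F (update (update ω z t) x u)| ≤ a z * |s - t| := by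
    intro u
    rw [update_comm hzx s u ω, update_comm hzx t u ω]
    exact hF z (update ω x u) s t
  have hdiff : Integrable (fun u => (F (update (update ω z s) x u) - F (update (update ω z t) x u)) * exp (-V (update (update ω z s) x u))) := by
    refine ((hI0.const_mul (a z * |s - t|))).mono' ?_ (ae_of_all _ fun u => ?_)
    · have hc1 : Continuous fun u => F (update (update ω z s) x u) := lip_continuous (hF x (update ω z s))
      have hc2 : Continuous fun u => F (update (update ω z t) x u) := lip_continuous (hF x (update ω z t))
      have hc3 : Continuous fun u => exp (-V (update (update ω z s) x u)) :=
        continuous_exp.comp (continuous_iff_continuousAt.2 fun u => (line_hasDerivAt hV x (update ω z s) u).continuousAt).neg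
      exact ((hc1.sub hc2).mul hc3).aestronglyMeasurable
    · rw [norm_mul, Real.norm_eq_abs, Real.norm_of_nonneg (exp_pos _).le]
      calc |F (update (update ω z s) x u) - F (update (update ω z t) x u)| * exp (-V (update (update ω z s) x u))
          ≤ a z * |s - t| * exp (-V (update (update ω z s) x u)) := mul_le_mul_of_nonneg_right (hpt u) (exp_pos _).le
        _ = a z * |s - t| * exp (-V (update (update ω z s) x u)) := rfl
  have hIt : Integrable (fun u => F (update (update ω z t) x u) * exp (-V (update (update ω z s) x u))) := by
    have := hIs.sub hdiff
    refine this.congr (ae_of_all _ fun u => ?_)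
    simp only [Pi.sub_apply]; ring
  rw [← sub_div, ← integral_sub hIs hIt, abs_div, abs_of_pos hZ, div_le_iff₀ hZ]
  have e : ∀ u, F (update (update ω z s) x u) * exp (-V (update (update ω z s) x u)) -
      F (update (update ω z t) x u) * exp (-V (update (update ω z s) x u)) =
      (F (update (update ω z s) x u) - F (update (update ω z t) x u)) * exp (-V (update (update ω z s) x u)) := fun u => by ring
  simp_rw [e]
  calc |∫ u, (F (update (update ω z s) x u) - F (update (update ω z t) x u)) * exp (-V (update (update ω z s) x u))|
      ≤ ∫ u, |(F (update (update ω z s) x u) - F (update (update ω z t) x u)) * exp (-V (update (update ω z s) x u))| :=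
        abs_integral_le_integral_abs
    _ ≤ ∫ u, a z * |s - t| * exp (-V (update (update ω z s) x u)) := by
        have hpt' : ∀ u, |(F (update (update ω z s) x u) - F (update (update ω z t) x u)) * exp (-V (update (update ω z s) x u))| ≤
            a z * |s - t| * exp (-V (update (update ω z s) x u)) := fun u => by
          rw [abs_mul, abs_of_pos (exp_pos _)]
          exact mul_le_mul_of_nonneg_right (hpt u) (exp_pos _).le
        exact integral_mono_of_nonneg (ae_of_all _ fun u => abs_nonneg _) (hI0.const_mul _) (ae_of_all _ hpt')
    _ = a z * |s - t| * ∫ u, exp (-V (update (update ω z s) x u)) := integral_const_mul _ _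

/-- **The cross part** (Dobrushin's coefficient, (444)): for `z ≠ x`, moving `ω_z` from `t` to `s` inside the WEIGHT costs at most
`(J_{xz}∕c_x)·a_x·|s − t|`. [folklore] -/
theorem resample_abs_sub_le_cross (hV : ∀ x ω, HasDerivAt (fun s => V (update ω x s)) (V₁ x ω) (ω x))
    (hfloor : ∀ x ω s t, c x * (s - t) ^ 2 ≤ (V₁ x (update ω x s) - V₁ x (update ω x t)) * (s - t)) (hc : ∀ x, 0 < c x)
    (hceil : ∀ x ω s t, |V₁ x (update ω x s) - V₁ x (update ω x t)| ≤ Cw * |s - t|)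
    (hcross : ∀ x z, z ≠ x → ∀ ω s t, |V₁ x (update ω z s) - V₁ x (update ω z t)| ≤ J x z * |s - t|)
    (hF : ∀ z ω s t, |F (update ω z s) - F (update ω z t)| ≤ a z * |s - t|) {x z : ι} (hzx : z ≠ x) (ω : ι → ℝ) (s t : ℝ) :
    |(∫ u, F (update (update ω z t) x u) * exp (-V (update (update ω z s) x u))) / (∫ u, exp (-V (update (update ω z s) x u))) -
        (∫ u, F (update (update ω z t) x u) * exp (-V (update (update ω z t) x u))) / (∫ u, exp (-V (update (update ω z t) x u)))| ≤
      a x * (J x z * |s - t|) / c x := by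
  -- the two line potentials `w₀ = V(ω^{z,t;x,·})`, `w₁ = V(ω^{z,s;x,·})` and their letters
  have hw₀ := line_hasDerivAt hV x (update ω z t)
  have hw₁ := line_hasDerivAt hV x (update ω z s)
  have hk : ∀ u, |V₁ x (update (update ω z s) x u) - V₁ x (update (update ω z t) x u)| ≤ J x z * |s - t| := by
    intro u
    rw [update_comm hzx s u ω, update_comm hzx t u ω]
    exact hcross x z hzx (update ω x u) s t
  exact gibbs_mean_lipschitz hw₀ hw₁ (hfloor x (update ω z t)) (hfloor x (update ω z s)) (hc x) (hceil x (update ω z t))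
    (hceil x (update ω z s)) hk (hF x (update ω z t))

/-- **THE END — THE RESAMPLING OPERATOR PROPAGATES COORDINATE-LIPSCHITZ VECTORS BY DOBRUSHIN'S UPDATE** ((P1) of (442)): for `F` with
vector `a`, `P_xF` has vector `A_xa`, `(A_xa)_z = a_z + (J_{xz}∕c_x)a_x` for `z ≠ x` and `(A_xa)_x = 0`. [folklore] -/
theorem resample_lipVec
    (hP : ∀ x F ω, P x F ω = (∫ s, F (update ω x s) * exp (-V (update ω x s))) / ∫ s, exp (-V (update ω x s)))
    (hV : ∀ x ω, HasDerivAt (fun s => V (update ω x s)) (V₁ x ω) (ω x))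
    (hfloor : ∀ x ω s t, c x * (s - t) ^ 2 ≤ (V₁ x (update ω x s) - V₁ x (update ω x t)) * (s - t)) (hc : ∀ x, 0 < c x)
    (hceil : ∀ x ω s t, |V₁ x (update ω x s) - V₁ x (update ω x t)| ≤ Cw * |s - t|)
    (hcross : ∀ x z, z ≠ x → ∀ ω s t, |V₁ x (update ω z s) - V₁ x (update ω z t)| ≤ J x z * |s - t|) (x : ι)
    (F : (ι → ℝ) → ℝ) (a : ι → ℝ) (hF : ∀ z ω s t, |F (update ω z s) - F (update ω z t)| ≤ a z * |s - t|)
    (z : ι) (ω : ι → ℝ) (s t : ℝ) :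
    |P x F (update ω z s) - P x F (update ω z t)| ≤ (if z = x then 0 else a z + J x z / c x * a x) * |s - t| := by
  split_ifs with hzx
  · subst hzx
    rw [resample_update_self hP, resample_update_self hP, sub_self, abs_zero, zero_mul]
  · rw [hP, hP]
    have h1 := resample_abs_sub_le_direct hV hfloor hc hF hzx ω s t
    have h2 := resample_abs_sub_le_cross hV hfloor hc hceil hcross hF hzx ω s t
    have htri := abs_sub_le
      ((∫ u, F (update (update ω z s) x u) * exp (-V (update (update ω z s) x u))) / (∫ u, exp (-V (update (update ω z s) x u))))
      ((∫ u, F (update (update ω z t) x u) * exp (-V (update (update ω z s) x u))) / (∫ u, exp (-V (update (update ω z s) x u))))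
      ((∫ u, F (update (update ω z t) x u) * exp (-V (update (update ω z t) x u))) / (∫ u, exp (-V (update (update ω z t) x u))))
    have e : (a z + J x z / c x * a x) * |s - t| = a z * |s - t| + a x * (J x z * |s - t|) / c x := by
      field_simp
    rw [e]
    linarith

/-! ## §3. Toy instance (kernel) -/

/-- Toy: on one site (`ι = Fin 1`) the update vector of any `a` vanishes at the resampled site `0`. -/
example (a : Fin 1 → ℝ) (J : Fin 1 → Fin 1 → ℝ) (c : Fin 1 → ℝ) :
    (if (0 : Fin 1) = 0 then (0 : ℝ) else a 0 + J 0 0 / c 0 * a 0) = 0 := by simp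

end Summit.QuantumFields.BalabanUV.T4Continuum.NE7b.SupOneSiteResampling

end
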